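import Summits.AtomisticToContinuum.Crystallization.Theorems.OverbindingBudgetAffineFarCoreWindowsC

/-!
# «FarCoreWindows» (lens-4 g65, 31280 GEN-37 (F) far core: layer coordinates, registry-free layer sums, Fubini, windows, Z2-S assembly, rows (N♯)/(X4)/(SC), Gram certificate, pattern-map leaf, finite window data) — part 4 of 4 (sequel of `…OverbindingBudgetAffineFarCoreWindowsC`)

Split for the 400-line cap by the landing lane (hand-2 g30); the module docstring of part 1 (`…OverbindingBudgetAffineFarCoreWindowsA`) describes the whole node.  Same namespace; all FQNs unchanged.
0 sorry; standard axioms.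
-/


namespace Summit.AtomisticToContinuum.Crystallization.Theorems.OverbindingBudgetAffineFarSmoothSplit

open scoped BigOperators Classical
open Literature.MathematicalPhysics.StatisticalMechanics
open Literature.Geometry.DiscreteGeometry (fccTwoShellPattern hcpTwoShellPattern)

local notation "E3" => EuclideanSpace ℝ (Fin 3)

/-! ## §8 The pattern-map leaf: `PatternFar ⇒ FarShape` (task (3)) -/

/-- `FarShape θ' s X μ`: the linear part `X`, read at its nearest distance `μ`, is `θ'`-FAR from every linear isometry ON THE CHART'S OWN reference two
shells: for every `Q` some two-shell vector `w` has `θ' μ < ‖X w − μ Q w‖` — the negation of what the zone-I rows (N)/(N♯) refute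
(`not_farShape_of_near`, `nSharpCheck_sound`). -/
def FarShape (θ' : ℝ) (s : ℤ → ℤ) (X : E3 →ₗ[ℝ] E3) (μ : ℝ) : Prop :=
  ∀ Q : E3 →ₗᵢ[ℝ] E3, ∃ w ∈ twoShellRef s, θ' * μ < ‖X w - μ • Q w‖

/-- `IsNearest s X μ`: `μ` is the nearest distance of `X` on the stacking coded by `s` (the attained minimum of `‖X p‖` over nonzero structure points). -/
def IsNearest (s : ℤ → ℤ) (X : E3 →ₗ[ℝ] E3) (μ : ℝ) : Prop :=
  (∀ p ∈ barlowStacking 1 (Real.sqrt (2 / 3)) s, p ≠ 0 → μ ≤ ‖X p‖) ∧ ∃ p ∈ barlowStacking 1 (Real.sqrt (2 / 3)) s, p ≠ 0 ∧ μ = ‖X p‖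

/-- ★ The PATTERN-MAP RIGIDITY leaf `(PF)` [ATTACKABLE·M, finite]: an injective map `π` of the fcc or the hcp two-shell pattern into a chart's reference two
shells which, read through a linear `X` within `m` of an isometry, is `τ₀`-close to a LINEAR frame `A₀`, is the restriction of a linear isometry.
(Enumeration behind it: the admissible `π` are restrictions of point-group elements — h↔h and c↔c only, none mixed — and the runner-up assignment misses
linearity by `≥ 1/2 ≫ τ₀`; an exact finite check over `ℤ[√2, √3]` like `TwoShellPatterns`.) -/
def PatternRigid (m τ₀ : ℝ) : Prop :=
  ∀ (s : ℤ → ℤ), IsHaggSeq s → ∀ (X A₀ : E3 →ₗ[ℝ] E3), (∃ Q : E3 →ₗᵢ[ℝ] E3, ∀ v, ‖X v - Q v‖ ≤ m * ‖v‖) →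
    ∀ (P : Finset E3) (π : E3 → E3), (P = fccTwoShellPattern ∨ P = hcpTwoShellPattern) →
      (∀ v ∈ P, π v ∈ twoShellRef s ∧ ‖X (π v) - A₀ v‖ ≤ τ₀) → Set.InjOn π ↑P →
        ∃ R : E3 →ₗᵢ[ℝ] E3, ∀ v ∈ P, π v = R v

/-- An admissible chart's `nn / a₀` IS the nearest distance of its linear part, and lies in `[5/6, 7/6]` when `θ ≤ 1/18`. [this file] -/
theorem chart_isNearest {θ : ℝ} (hθ : θ ≤ 1 / 18) {c : Chart} (hc : ChartAdmissible θ c) :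
    IsNearest c.s c.B (c.nn / c.a₀) ∧ 5 / 6 ≤ c.nn / c.a₀ ∧ c.nn / c.a₀ ≤ 7 / 6 := by
  obtain ⟨hs, ha, _, ⟨Q, hQ⟩, hle, ⟨p, hp, hp0, hpeq⟩, _⟩ := hc
  have hm : ∀ v : E3, ‖c.B v - Q v‖ ≤ 1 / 6 * ‖v‖ := fun v => (hQ v).trans (by nlinarith [norm_nonneg v])
  have hN : IsNearest c.s c.B (c.nn / c.a₀) :=
    ⟨fun q hq hq0 => by rw [div_le_iff₀ ha, mul_comm]; exact hle q hq hq0, ⟨p, hp, hp0, by rw [hpeq]; field_simp⟩⟩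
  refine ⟨hN, ?_, ?_⟩
  · have h1 : 1 ≤ ‖p‖ := one_le_norm_of_mem_barlowStacking hs hp hp0
    have hB : ‖Q p‖ - ‖c.B p - Q p‖ ≤ ‖c.B p‖ := by
      have := norm_sub_norm_le (Q p) (c.B p); rw [norm_sub_rev] at this; linarith
    rw [Q.norm_map] at hB
    have hμ : c.nn / c.a₀ = ‖c.B p‖ := by rw [hpeq]; field_simp
    rw [hμ]
    linarith [hm p]
  · obtain ⟨q, hq, hq0, hq1⟩ := exists_mem_barlowStacking_norm_eq_one c.s
    have hB : ‖c.B q‖ ≤ ‖Q q‖ + ‖c.B q - Q q‖ := by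
      have := norm_add_le (Q q) (c.B q - Q q); rwa [add_sub_cancel] at this
    rw [Q.norm_map, hq1] at hB
    have := hN.1 q hq hq0
    linarith [hm q, hq1]

/-- The NORMALISED linear part `(a₀/nn) • B` of an admissible chart (`θ ≤ 1/18`) is within `2/5` of a linear isometry. [this file] -/
theorem chart_normalised_near {θ : ℝ} (hθ : θ ≤ 1 / 18) {c : Chart} (hc : ChartAdmissible θ c) :
    ∃ Q : E3 →ₗᵢ[ℝ] E3, ∀ v : E3, ‖((c.a₀ / c.nn) • c.B) v - Q v‖ ≤ 2 / 5 * ‖v‖ := by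
  obtain ⟨_, hlo, hhi⟩ := chart_isNearest hθ hc
  obtain ⟨Q, hQ⟩ := hc.2.2.2.1
  have hm : ∀ v : E3, ‖c.B v - Q v‖ ≤ 1 / 6 * ‖v‖ := fun v => (hQ v).trans (by nlinarith [norm_nonneg v])
  have hμ : 0 < c.nn / c.a₀ := by linarith
  have hr : c.a₀ / c.nn = (c.nn / c.a₀)⁻¹ := by rw [inv_div]
  have hrlo : 6 / 7 ≤ c.a₀ / c.nn := by rw [hr, le_inv_comm₀ (by norm_num) hμ]; linarith
  have hrhi : c.a₀ / c.nn ≤ 6 / 5 := by rw [hr, inv_le_comm₀ hμ (by norm_num)]; linarith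
  refine ⟨Q, fun v => ?_⟩
  rw [LinearMap.smul_apply]
  have e : (c.a₀ / c.nn) • c.B v - Q v = (c.a₀ / c.nn) • (c.B v - Q v) + (c.a₀ / c.nn - 1) • Q v := by
    rw [smul_sub, sub_smul, one_smul]; abel
  rw [e]
  refine (norm_add_le _ _).trans ?_
  rw [norm_smul, norm_smul, Q.norm_map, Real.norm_of_nonneg (by linarith : (0 : ℝ) ≤ c.a₀ / c.nn), Real.norm_eq_abs]
  have h1 : c.a₀ / c.nn * ‖c.B v - Q v‖ ≤ 6 / 5 * (1 / 6 * ‖v‖) := mul_le_mul hrhi (hm v) (norm_nonneg _) (by norm_num)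
  have h2 : |c.a₀ / c.nn - 1| * ‖v‖ ≤ 1 / 5 * ‖v‖ := mul_le_mul_of_nonneg_right (abs_le.mpr ⟨by linarith, by linarith⟩) (norm_nonneg _)
  linarith

/-- ★ **`PatternFar ⇒ FarShape`** [thm, given the leaf (PF)]: for an admissible chart (`θ ≤ 1/18`) that is `PatternFar θ₀ τ`, the linear part read at its own
nearest distance `nn/a₀` is `(θ₀ − τ)`-far from every isometry on the chart's own two shells.  (Rigidity turns the pattern map `π` into an isometry `R`;
test the far frame against `Q' ∘ R`; triangle inequality with the `τ`-registration.) [this file] -/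
theorem farShape_of_patternFar {θ θ₀ τ : ℝ} (hθ : θ ≤ 1 / 18) (hrig : PatternRigid (2 / 5) τ) {c : Chart} (hc : ChartAdmissible θ c)
    (hfar : PatternFar θ₀ τ c) : IsNearest c.s c.B (c.nn / c.a₀) ∧ FarShape (θ₀ - τ) c.s c.B (c.nn / c.a₀) := by
  obtain ⟨hN, hlo, hhi⟩ := chart_isNearest hθ hc
  refine ⟨hN, fun Q' => ?_⟩
  obtain ⟨A₀, P, π, hP, hπ, hinj, hfarA⟩ := hfar
  have hπ' : ∀ v ∈ P, π v ∈ twoShellRef c.s ∧ ‖((c.a₀ / c.nn) • c.B) (π v) - A₀ v‖ ≤ τ := fun v hv => by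
    rw [LinearMap.smul_apply]; exact hπ v hv
  obtain ⟨R, hR⟩ := hrig c.s hc.1 ((c.a₀ / c.nn) • c.B) A₀ (chart_normalised_near hθ hc) P π hP hπ' hinj
  obtain ⟨v, hv, hθ₀⟩ := hfarA (Q'.comp R)
  have hθ₀' : θ₀ < ‖A₀ v - Q' (π v)‖ := by rw [hR v hv]; exact hθ₀
  refine ⟨π v, (hπ v hv).1, ?_⟩
  have hμ : 0 < c.nn / c.a₀ := by linarith
  have htri : ‖A₀ v - Q' (π v)‖ ≤ ‖(c.a₀ / c.nn) • c.B (π v) - A₀ v‖ + ‖(c.a₀ / c.nn) • c.B (π v) - Q' (π v)‖ := by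
    have := norm_sub_le ((c.a₀ / c.nn) • c.B (π v) - A₀ v) ((c.a₀ / c.nn) • c.B (π v) - Q' (π v))
    rwa [sub_sub_sub_cancel_left, norm_sub_rev] at this
  have hreg := (hπ v hv).2
  have hK : θ₀ - τ < ‖(c.a₀ / c.nn) • c.B (π v) - Q' (π v)‖ := by linarith
  have ha := hc.2.1
  have hnn := hc.2.2.1
  have h1 : c.nn / c.a₀ * (c.a₀ / c.nn) = 1 := by field_simp
  have e : c.B (π v) - (c.nn / c.a₀) • Q' (π v) = (c.nn / c.a₀) • ((c.a₀ / c.nn) • c.B (π v) - Q' (π v)) := by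
    rw [smul_sub, smul_smul, h1, one_smul]
  rw [e, norm_smul, Real.norm_of_nonneg hμ.le]
  linarith [mul_lt_mul_of_pos_left hK hμ]

/-- The zone-I-free TABLE REGION: an `IsHagg` window `w`, a linear part `X` within `3θ` of an isometry, its nearest distance `μ`, and `FarShape θ' s X μ`
for some Hägg sequence `s` with window `w` (the reference two shells and the nearest distance only see layers `|k| ≤ 1`, i.e. the window). -/
def FarWindowGood (θ θ' : ℝ) (w : Fin 6 → ℤ) (X : E3 →ₗ[ℝ] E3) : Prop :=
  ∃ (s : ℤ → ℤ) (μ : ℝ), IsHaggSeq s ∧ windowOf s = w ∧ (∃ Q : E3 →ₗᵢ[ℝ] E3, ∀ v : E3, ‖X v - Q v‖ ≤ 3 * θ * ‖v‖) ∧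
    IsNearest s X μ ∧ FarShape θ' s X μ

/-- ★ **Z2-S from the leaf (PF) and per-window certificates on the far region**: given pattern-map rigidity and, for every far window `(w, X)`, the
certificate `windowSixUp² ≤ 24 Φ · windowTwelveLo`, the shape bound `CoreFarShapeBound θ θ₀ Φ τ` follows. [this file] -/
theorem coreFarShapeBound_of_farWindows {θ θ₀ Φ τ : ℝ} (hθ : θ ≤ 1 / 18) (hΦ : 0 ≤ Φ) (hrig : PatternRigid (2 / 5) τ)
    (hcert : ∀ (w : Fin 6 → ℤ) (X : E3 →ₗ[ℝ] E3), FarWindowGood θ (θ₀ - τ) w X → windowSixUp w X ^ 2 ≤ 24 * Φ * windowTwelveLo w X) :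
    CoreFarShapeBound θ θ₀ Φ τ :=
  coreFarShapeBound_of_windowSums hθ hΦ fun w B hg => by
    obtain ⟨c, hc, hfar, hB, hw⟩ := hg
    obtain ⟨hN, hF⟩ := farShape_of_patternFar hθ hrig hc hfar
    subst hB; subst hw
    exact hcert _ _ ⟨c.s, c.nn / c.a₀, hc.1, rfl, hc.2.2.2.1, hN, hF⟩

/-- ★ **The g65 record shape of Z2**: `HcpEnergyUpper u` (interval arithmetic) + the pattern-map leaf `(PF)` + the per-far-window certificates
(zone I is now EMPTY by `FarShape`; zones II/III by rows (X2)/(X4)/(SC)/(N♯-complement)) ⇒ `FarCoreExcess (1/25) (1/2000) (1/(2·10⁷))`. [this file] -/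
theorem farCoreExcess_record_of_farWindows {u τ : ℝ} (hτ : 0 < τ) (hU : HcpEnergyUpper u) (hu : u + 1 / (2 * 10 ^ 7) + 1 / 10 ^ 9 ≤ 0)
    (hrig : PatternRigid (2 / 5) τ)
    (hcert : ∀ (w : Fin 6 → ℤ) (X : E3 →ₗ[ℝ] E3), FarWindowGood (1 / 25) (1 / 2000 - τ) w X →
      windowSixUp w X ^ 2 ≤ 24 * (-(u + 1 / (2 * 10 ^ 7) + 1 / 10 ^ 9)) * windowTwelveLo w X) :
    FarCoreExcess (1 / 25) (1 / 2000) (1 / (2 * 10 ^ 7)) :=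
  farCoreExcess_record_of_certificate hτ hU (coreFarShapeBound_of_farWindows (by norm_num) (by linarith) hrig hcert)

/-! ## §9 The far-window hypotheses are FINITE WINDOW DATA (uses `…TwoShellWindow`: the 18 two-shell / 12 first-shell index triples of a window)

For `t = (k, i, j)` with `|k| ≤ 1` the structure point is `wPos w t := layerVec i j (windowLabel w k) k` — a function of the WINDOW (`idxPos_eq_wPos`);
`FarShape` is a check over the 18 triples `twoShellIdx (s 0) (−s(−1))` (`farShape_iff_finite`) and `IsNearest` the attained minimum over the 12 triples
`firstShellIdx (s 0) (−s(−1))` (`isNearest_iff_finite`, first shell wins).  Hence every row of the table receives from `FarWindowGood θ θ' w X` exactly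
the finite data `FarWindowData θ θ' w X` (a sign window, `X` `3θ`-near an isometry, `μ` = the attained first-shell minimum of `‖X (wPos w t)‖`, the finite
far-clause), and the record holds from a table over `FarWindowData` (`farCoreExcess_record_of_farWindowData`). -/

/-- The structure point of an index triple `(k, i, j)`, `|k| ≤ 3`, computed from the WINDOW. -/
noncomputable def wPos (w : Fin 6 → ℤ) (t : ℤ × ℤ × ℤ) : E3 := layerVec t.2.1 t.2.2 (windowLabel w t.1) t.1

/-- `w 3 = s 0`. [this file] -/
theorem windowOf_three (s : ℤ → ℤ) : windowOf s 3 = s 0 := congrArg s (by decide)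

/-- `w 2 = s(−1)`. [this file] -/
theorem windowOf_two (s : ℤ → ℤ) : windowOf s 2 = s (-1) := congrArg s (by decide)

/-- On the layers `0, ±1` the structure point of a triple is the window's `wPos`. [this file] -/
theorem idxPos_eq_wPos (s : ℤ → ℤ) {t : ℤ × ℤ × ℤ} (hk : t.1 = 0 ∨ t.1 = 1 ∨ t.1 = -1) : idxPos s t = wPos (windowOf s) t := by
  have h3 : |t.1| ≤ 3 := by rcases hk with h | h | h <;> norm_num [h]
  rw [idxPos, barlowPos_eq_layerVec, haggLabel_eq_windowLabel s h3]
  rfl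

/-- ★ `FarShape` is a FINITE check over the 18 two-shell triples of the window. [this file] -/
theorem farShape_iff_finite {θ' μ : ℝ} {s : ℤ → ℤ} (hs : IsHaggSeq s) (X : E3 →ₗ[ℝ] E3) :
    FarShape θ' s X μ ↔ ∀ Q : E3 →ₗᵢ[ℝ] E3, ∃ t ∈ twoShellIdx (s 0) (-s (-1)),
      θ' * μ < ‖X (wPos (windowOf s) t) - μ • Q (wPos (windowOf s) t)‖ := by
  obtain ⟨hop, hom⟩ := labels_sign hs
  have hw : ∀ t ∈ twoShellIdx (s 0) (-s (-1)), idxPos s t = wPos (windowOf s) t := fun t ht =>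
    idxPos_eq_wPos s (layer_of_mem_twoShellIdx hop hom t ht)
  constructor
  · intro h Q
    obtain ⟨v, hv, hlt⟩ := h Q
    obtain ⟨t, ht, rfl⟩ := (mem_twoShellRef_iff hs).1 hv
    refine ⟨t, ht, ?_⟩
    rw [← hw t ht]; exact hlt
  · intro h Q
    obtain ⟨t, ht, hlt⟩ := h Q
    refine ⟨idxPos s t, (mem_twoShellRef_iff hs).2 ⟨t, ht, rfl⟩, ?_⟩
    rw [hw t ht]; exact hlt

/-- ★ `IsNearest` is a FINITE check: the attained minimum over the 12 first-shell triples of the window (for `X` within `m ≤ 1/6` of a linear isometry;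
first shell wins, `norm_map_first_shell_le`). [this file] -/
theorem isNearest_iff_finite {s : ℤ → ℤ} (hs : IsHaggSeq s) {X : E3 →ₗ[ℝ] E3} {m : ℝ} (hm : m ≤ 1 / 6)
    (hX : ∃ Q : E3 →ₗᵢ[ℝ] E3, ∀ v : E3, ‖X v - Q v‖ ≤ m * ‖v‖) (μ : ℝ) :
    IsNearest s X μ ↔ (∀ t ∈ firstShellIdx (s 0) (-s (-1)), μ ≤ ‖X (wPos (windowOf s) t)‖) ∧
      ∃ t ∈ firstShellIdx (s 0) (-s (-1)), μ = ‖X (wPos (windowOf s) t)‖ := by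
  obtain ⟨hop, hom⟩ := labels_sign hs
  have hw : ∀ t ∈ firstShellIdx (s 0) (-s (-1)), idxPos s t = wPos (windowOf s) t := fun t ht =>
    idxPos_eq_wPos s (layer_of_mem_twoShellIdx hop hom t (Finset.mem_union_left _ ht))
  unfold IsNearest
  rw [nearest_iff_firstShell hs hm hX μ]
  constructor
  · rintro ⟨h1, t, ht, h2⟩
    refine ⟨fun t' ht' => ?_, t, ht, ?_⟩
    · rw [← hw t' ht']; exact h1 t' ht'
    · rw [← hw t ht]; exact h2
  · rintro ⟨h1, t, ht, h2⟩
    refine ⟨fun t' ht' => ?_, t, ht, ?_⟩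
    · rw [hw t' ht']; exact h1 t' ht'
    · rw [hw t ht]; exact h2

/-- The FINITE DATA of a far window: a sign window, `X` `3θ`-near a linear isometry, a `μ` attained as the minimum of `‖X (wPos w t)‖` over the 12 first-shell
triples `firstShellIdx (w 3) (−w 2)`, and the far-clause over the 18 two-shell triples `twoShellIdx (w 3) (−w 2)`. -/
def FarWindowData (θ θ' : ℝ) (w : Fin 6 → ℤ) (X : E3 →ₗ[ℝ] E3) : Prop :=
  (∀ i, w i = 1 ∨ w i = -1) ∧ (∃ Q : E3 →ₗᵢ[ℝ] E3, ∀ v : E3, ‖X v - Q v‖ ≤ 3 * θ * ‖v‖) ∧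
    ∃ μ : ℝ, (∀ t ∈ firstShellIdx (w 3) (-w 2), μ ≤ ‖X (wPos w t)‖) ∧ (∃ t ∈ firstShellIdx (w 3) (-w 2), μ = ‖X (wPos w t)‖) ∧
      ∀ Q : E3 →ₗᵢ[ℝ] E3, ∃ t ∈ twoShellIdx (w 3) (-w 2), θ' * μ < ‖X (wPos w t) - μ • Q (wPos w t)‖

/-- ★ **Each table row's hypotheses are finite window data** (`θ ≤ 1/18`). [this file] -/
theorem farWindowData_of_good {θ θ' : ℝ} (hθ : θ ≤ 1 / 18) {w : Fin 6 → ℤ} {X : E3 →ₗ[ℝ] E3} (h : FarWindowGood θ θ' w X) :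
    FarWindowData θ θ' w X := by
  obtain ⟨s, μ, hs, rfl, hX, hN, hF⟩ := h
  have hm : 3 * θ ≤ 1 / 6 := by linarith
  refine ⟨fun i => hs _, hX, μ, ?_⟩
  rw [windowOf_three, windowOf_two]
  obtain ⟨h1, h2⟩ := (isNearest_iff_finite hs hm hX μ).1 hN
  exact ⟨h1, h2, (farShape_iff_finite hs X).1 hF⟩

/-- ★ Z2-S from the pattern-map leaf and a table over the FINITE far-window data. [this file] -/
theorem coreFarShapeBound_of_farWindowData {θ θ₀ Φ τ : ℝ} (hθ : θ ≤ 1 / 18) (hΦ : 0 ≤ Φ) (hrig : PatternRigid (2 / 5) τ)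
    (hcert : ∀ (w : Fin 6 → ℤ) (X : E3 →ₗ[ℝ] E3), FarWindowData θ (θ₀ - τ) w X → windowSixUp w X ^ 2 ≤ 24 * Φ * windowTwelveLo w X) :
    CoreFarShapeBound θ θ₀ Φ τ :=
  coreFarShapeBound_of_farWindows hθ hΦ hrig fun w X h => hcert w X (farWindowData_of_good hθ h)

/-- ★ **THE RECORD, finite-data form**: `Z2 ⟸ HcpEnergyUpper u ∧ PatternRigid (2/5) τ ∧ ∀ (w, X) with FarWindowData, T₃↑(w,X)² ≤ 24Φ·T₆↓(w,X)`,
`Φ = −(u + 1/(2·10⁷) + 10⁻⁹)`. [this file] -/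
theorem farCoreExcess_record_of_farWindowData {u τ : ℝ} (hτ : 0 < τ) (hU : HcpEnergyUpper u) (hu : u + 1 / (2 * 10 ^ 7) + 1 / 10 ^ 9 ≤ 0)
    (hrig : PatternRigid (2 / 5) τ)
    (hcert : ∀ (w : Fin 6 → ℤ) (X : E3 →ₗ[ℝ] E3), FarWindowData (1 / 25) (1 / 2000 - τ) w X →
      windowSixUp w X ^ 2 ≤ 24 * (-(u + 1 / (2 * 10 ^ 7) + 1 / 10 ^ 9)) * windowTwelveLo w X) :
    FarCoreExcess (1 / 25) (1 / 2000) (1 / (2 * 10 ^ 7)) :=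
  farCoreExcess_record_of_certificate hτ hU (coreFarShapeBound_of_farWindowData (by norm_num) (by linarith) hrig hcert)

/-! ## §7 Pins -/

/-- The hcp window `(+,−,+,−,+,−)` (layers `−3 … 2` of `alternatingHagg`, up to the global sign): labels `0, −1, 0, −1` at `k = 0, 1, 2, 3` and
`−1, 0, −1` at `k = −1, −2, −3` — the `ABAB…` pattern. -/
example : (windowLabel ![1, -1, 1, -1, 1, -1] 1, windowLabel ![1, -1, 1, -1, 1, -1] 2, windowLabel ![1, -1, 1, -1, 1, -1] 3,
    windowLabel ![1, -1, 1, -1, 1, -1] (-1), windowLabel ![1, -1, 1, -1, 1, -1] (-2), windowLabel ![1, -1, 1, -1, 1, -1] (-3)) =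
    (-1, 0, -1, -1, 0, -1) := by decide

/-- A c-centred aligned window `(+,−,−,+,−,+)` (word `BACABAB` of memo §0: an fcc-like triple `s(−2) = s(−1)` below an hcp-like centre): its layer
`−3` carries label `1 ≡ −2`, i.e. the THIRD coset — invisible to any `|k| ≤ 2` datum. -/
example : (windowLabel ![1, -1, -1, 1, -1, 1] (-1), windowLabel ![1, -1, -1, 1, -1, 1] (-2), windowLabel ![1, -1, -1, 1, -1, 1] (-3)) =
    (1, 2, 1) := by decide

/-- Inside the window the upper and lower layer functions coincide (no slack at `|k| ≤ 3`). -/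
example (w : Fin 6 → ℤ) (B : E3 →ₗ[ℝ] E3) (n : ℕ) : layerUp w B n 3 = layerLo w B n 3 := by
  simp [layerUp, layerLo]

end Summit.AtomisticToContinuum.Crystallization.Theorems.OverbindingBudgetAffineFarSmoothSplit
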